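/-
Copyright (c) 2026 the pub-hodgecm-mathlib formalisation cell (harness21).  Prover seat hodgecm-mathlib-K2Liu-p08 (g3): Track B «K2-LIT»,
hLiu418 = stmt-HodgeConjecture-24832; LEAD F0P6-plan (g13) RULING «M-157o» (#42S-S5 road (d)) and CUT (B) «CENTRAL RAY» of record
2026-09-04T09:52:40Z, file F1b-ray.
-/
import Summits.HodgeConjecture.HodgeConjecture.Theorems.K2LiuSiegelDoubledUnipotentScaling     -- ★ `exists_haar_conjBy_scaling` (centre scaling, squaring trick)
import Summits.HodgeConjecture.HodgeConjecture.Theorems.K2LiuSingularSectionVanishes           -- ★ S5-W4 frame algebra: `adapt_blk_weylDelta`, `modDelta_of_blk_eq_levi_scalar`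
import Summits.HodgeConjecture.HodgeConjecture.Theorems.K2LiuSiegelLeviConjUnipDeltaChar        -- ★ `conj_mem_unipDelta`
import Summits.HodgeConjecture.HodgeConjecture.Theorems.K2LiuSiegelUnipotentHaarPinned         -- ★ `locallyCompactSpace_unipDelta`, `secondCountableTopology_unipDelta`
import Mathlib.MeasureTheory.Measure.Haar.Unique
import HarnessLib

/-!
# Crux `HLiu418`, road `K2_Liu`, #42S-S5 «incoherent pieces die», file F1b-ray:
# THE CENTRAL-RAY EIGEN-LAW OF THE SIEGEL INTERTWINING INTEGRAL — `M(s)f (m(z·1) h) = |z|_𝔸^{n²} · δ_{χ,s}(m(z⁻¹·1)) · M(s)f (h)`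

Cell `hodgecm-mathlib`, crux item hLiu418 = `stmt-HodgeConjecture-24832`; squad K2 ∕ K2Liu; prover K2Liu-p08 (g3).  THEOREMS ONLY (no `def`, no
instance, no notation, no named-fact hypothesis, no `sorry`); lane `--supports stmt-HodgeConjecture-24832 --as helper` (count-neutral helper).
GENERIC `n`, doubled frame `H(𝔸) = HA L e dV hdV dW hdW`; `N_Δ(𝔸) = unipDelta` with a caller-supplied Borel structure and ANY Haar measure `νN`;
`M f (h) = intertwiningDelta νN f h = ∫_{N_Δ(𝔸)} f(w_Δ u h) dνN(u)` (★ D9).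

THE POINT (cut (B) of LEAD F0P6-plan (g13) 09:52:40Z).  S5-F2 kills `E⋆(0) = a(0)·φ₀ + M⋆(0)φ₀` with ★ S5-W4 (ray form,
`K2LiuSingularSectionVanishesRay.eq_zero_of_isSiegelDeltaSection_add_centralRay_eigen`), which needs of `M⋆(0)φ₀` only its EIGEN-LAW under the
CENTRAL scalar Levi element `m_z = m(z·1)`, `z = z(eˢ)` the positive real scalar idele (★ `posRealIdele`).  On Godement's half-plane that law is
elementary and needs NO general modulus of `P_Δ(𝔸)` on `N_Δ(𝔸)` and NO Levi decomposition — only the CENTRE scaling of the Haar measure of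
`N_Δ(𝔸)`, which is ★ (`K2LiuSiegelDoubledUnipotentScaling.exists_haar_conjBy_scaling`, the squaring trick):
  `M f (m_z h) = ∫ f(w_Δ u m_z h) du = ∫ f(w_Δ m_z (m_z⁻¹ u m_z) h) du = |z|_𝔸^{n²} ∫ f((w_Δ m_z w_Δ) w_Δ v h) dv = |z|_𝔸^{n²} · δ_{χ,s}(m_{z⁻¹}) · M f (h)`,
since `w_Δ m(z·1) w_Δ = m(z⁻¹·1)` (frame algebra of ★ S5-W4: `adapt(blk w_Δ) = (0 1; 1 0)`) and `f ∈ I(s, χ)`.  F1b-β (★ `K2LiuRankOneCentreContinuation.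
constTerm_sub_apply_mul_eq`) transports the law to the centre.

CONTENTS.
* §1 frame: `blk_weylDelta_mul_mul_weylDelta_of_blk_eq_levi` (`w_Δ m(A,D) w_Δ = m(D,A)`); the chart's centre element `φ(z(eˢ))` IS the scalar Levi
  element `m(z·1)` (`blk_chart_scalarExp`), so any `p` with that block matrix is it (★ `eq_of_blk_eq`).
* §2 **`map_conj_centralRay_eq_smul`** — for EVERY Haar measure `νN` on `N_Δ(𝔸)` and the scalar Levi element `p = m(z(eˢ)·1)`:
  `(u ↦ p⁻¹ u p)_* νN = e^{n²[L:ℚ]s} • νN` (★ centre scaling, transported along `N_Δ ≅ unipDelta` and Haar uniqueness, Mathlib `isMulLeftInvariant_eq_smul`).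
* §3 **`intertwiningDelta_centralRay`** — THE EIGEN-LAW: for a Siegel section `f ∈ I(s, χ)` and ANY `p′` with `blk p′ = m(z⁻¹·1)`,
  `M f (p h) = e^{n²[L:ℚ]s′} · δ_{χ,s}(p′) · M f (h)` (no integrability needed: a measurable equivalence, a scalar multiple of the measure, a left
  factor); **`intertwiningDelta_centralRay_explicit`**: the scalar is `e^{n²[L:ℚ]s′} · χ(zⁿ)⁻¹ · |z⁻ⁿ|_𝔸^{s + n∕2}` and its norm is
  `exp([L:ℚ]·n·s′·(n∕2 − Re s))` (`norm_centralRay_eigenvalue`), `≠ 1` off `Re s = n∕2` for `s′ ≠ 0` — at the rank-one centre `Re s = 0` in particular.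
HONEST LABEL.  `HC_CM` is proved only modulo the 7 printed citations (2 remaining named inputs: hLiu418 = `stmt-HodgeConjecture-24832`,
h413 = `stmt-HodgeConjecture-24833`) until rung 0 closes.

## References
* [MoeglinWaldspurger1995] C. Mœglin, J.-L. Waldspurger, *Spectral decomposition and Eisenstein series* (1995), I.2.1, II.1.6 (intertwining operators,
  `M(s) : I(s) → I(−s)`; action of the centre of the Levi).
* [HarrisKudlaSweet1996] M. Harris, S. Kudla, W. J. Sweet, J. Amer. Math. Soc. 9 (1996), §1 (1.11)–(1.15) (`m(a)`, `n(b)`, `w`, modulus `|det a|^{n}`).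
* [Garrett2018] P. Garrett, *Modern Analysis of Automorphic Forms by Example* (2018), §3.10 (`d(m n m⁻¹) = δ(m) dn`).
* [JiangWu2016ChiB] D. Jiang, C. Wu, J. Number Theory 161 (2016), Prop. 4.1.
-/

set_option autoImplicit false
set_option linter.dupNamespace false -- the mandated namespace repeats `HodgeConjecture.HodgeConjecture`

noncomputable section

open scoped Matrix NNReal ENNReal
open NumberField IsDedekindDomain MeasureTheory MeasureTheory.Measure

namespace Summit.HodgeConjecture.HodgeConjecture.Cruxes.HLiu418.K2LiuIntertwiningCentralRayEigen

open Literature.NumberTheory.GelbartRogawski1991.AdaptedBlocks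
open Literature.NumberTheory.Automorphic Literature.NumberTheory.Automorphic.UnitaryGroup
open Literature.NumberTheory.GelbartRogawski1991 Literature.NumberTheory.GelbartRogawski1991.GRConstruction
open Literature.NumberTheory.K2Lit.SiegelDoubled Literature.NumberTheory.GaloisRepresentations
open UnitaryDualPair
open Summit.HodgeConjecture.HodgeConjecture.Cruxes.HLiu418.K2LiuSiegelDoubledLeviAlgebra
open Summit.HodgeConjecture.HodgeConjecture.Cruxes.HLiu418.K2LiuSiegelDoubledBlkUnitary
open Summit.HodgeConjecture.HodgeConjecture.Cruxes.HLiu418.K2LiuSiegelDoubledLeviMatrix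
open Summit.HodgeConjecture.HodgeConjecture.Cruxes.HLiu418.K2LiuSiegelDoubledLeviChart
open Summit.HodgeConjecture.HodgeConjecture.Cruxes.HLiu418.K2LiuSiegelDoubledUnipotentChart
open Summit.HodgeConjecture.HodgeConjecture.Cruxes.HLiu418.K2LiuSiegelDoubledUnipotentScaling
open Summit.HodgeConjecture.HodgeConjecture.Cruxes.HLiu418.K2LiuSingularSectionVanishes
open Summit.HodgeConjecture.HodgeConjecture.Cruxes.HLiu418.K2LiuSiegelEisensteinDoubledSummableReduction (norm_siegelDeltaCharacter)
open Summit.HodgeConjecture.HodgeConjecture.Cruxes.HLiu418.K2LiuSiegelLeviConjUnipDeltaChar (conj_mem_unipDelta)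
open Summit.HodgeConjecture.HodgeConjecture.Cruxes.HLiu418.K2LiuSiegelUnipotentHaarPinned (locallyCompactSpace_unipDelta secondCountableTopology_unipDelta)

variable (L : Type) [Field L] [NumberField L] [IsCMField L]
variable {N M n : ℕ} (e : Fin N × Fin M ≃ Fin n)
  (dV : Fin N → L) (hdV : ∀ i, IsCMField.complexConj L (dV i) = dV i)
  (dW : Fin M → L) (hdW : ∀ i, IsCMField.complexConj L (dW i) = dW i)

/-! ## §1 Frame: `w_Δ m(A, D) w_Δ = m(D, A)`; the chart's centre element is the scalar Levi element -/

/-- **`w_Δ · m(A, D) · w_Δ = m(D, A)`**: conjugating a Levi element by the Weyl element swaps its two adapted blocks (`adapt(blk w_Δ) = (0 1; 1 0)`,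
★ `adapt_blk_weylDelta`).  [cite: HarrisKudlaSweet1996, §1 (1.11)] [cite: MoeglinWaldspurger1995, I.2.1] -/
theorem blk_weylDelta_mul_mul_weylDelta_of_blk_eq_levi {p : HA L e dV hdV dW hdW} {A D : Matrix (Fin n) (Fin n) (AdeleRing (𝓞 L) L)}
    (hp : blk L e dV hdV dW hdW p = cayR (AdeleRing (𝓞 L) L) (Fin n) * Matrix.fromBlocks A 0 0 D * cayRinv (AdeleRing (𝓞 L) L) (Fin n)) :
    blk L e dV hdV dW hdW (weylDelta L e dV hdV dW hdW * p * weylDelta L e dV hdV dW hdW) =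
      cayR (AdeleRing (𝓞 L) L) (Fin n) * Matrix.fromBlocks D 0 0 A * cayRinv (AdeleRing (𝓞 L) L) (Fin n) := by
  apply eq_of_adapt_eq
  rw [blk_mul, blk_mul, adapt_mul, adapt_mul, hp, adapt_levi, adapt_levi, adapt_blk_weylDelta]
  simp only [Matrix.fromBlocks_multiply, Matrix.mul_zero, Matrix.zero_mul, Matrix.one_mul, Matrix.mul_one, add_zero, zero_add]

/-- `σ(z⁻¹) = z⁻¹` for the positive real scalar idele `z = z(r)` (★ `map_conjAdele_posRealIdele`). [cite: HarrisKudlaSweet1996, §1 (1.11)] -/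
theorem conjAdele_posRealIdele_inv (r : ℝ≥0ˣ) :
    conjAdele (Fp L) L (IsCMField.complexConj L) (((posRealIdele L r)⁻¹ : (AdeleRing (𝓞 L) L)ˣ) : AdeleRing (𝓞 L) L) =
      (((posRealIdele L r)⁻¹ : (AdeleRing (𝓞 L) L)ˣ) : AdeleRing (𝓞 L) L) := by
  have h := congrArg (fun u : (AdeleRing (𝓞 L) L)ˣ => ((u⁻¹ : (AdeleRing (𝓞 L) L)ˣ) : AdeleRing (𝓞 L) L))
    (DoubledUnitary.RankOneReduction.map_conjAdele_posRealIdele (Fp L) L (IsCMField.complexConj L) r)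
  simpa only [← map_inv, Units.coe_map, MonoidHom.coe_coe] using h

/-- **the Levi shape of a scalar**: `m(g)` for `g = z·1` with `σ z = z` has `D`-block `T⁻¹ σ(g⁻¹)ᵀ T = z⁻¹·1`. [cite: HarrisKudlaSweet1996, §1 (1.11)] -/
theorem levi_D_block_scalar {z : (AdeleRing (𝓞 L) L)ˣ} (hdV0 : ∀ i, dV i ≠ 0) (hdW0 : ∀ i, dW i ≠ 0)
    (hz : conjAdele (Fp L) L (IsCMField.complexConj L) ((z⁻¹ : (AdeleRing (𝓞 L) L)ˣ) : AdeleRing (𝓞 L) L) = ((z⁻¹ : (AdeleRing (𝓞 L) L)ˣ) : AdeleRing (𝓞 L) L)) :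
    ((gramR L e dV hdV dW hdW).map ((algebraMap L (AdeleRing (𝓞 L) L)).comp (algebraMap (Fp L) L)))⁻¹ *
        ((((z⁻¹ : (AdeleRing (𝓞 L) L)ˣ) : AdeleRing (𝓞 L) L) • (1 : Matrix (Fin n) (Fin n) (AdeleRing (𝓞 L) L))).map
          (conjAdele (Fp L) L (IsCMField.complexConj L)))ᵀ *
        (gramR L e dV hdV dW hdW).map ((algebraMap L (AdeleRing (𝓞 L) L)).comp (algebraMap (Fp L) L)) =
      ((z⁻¹ : (AdeleRing (𝓞 L) L)ˣ) : AdeleRing (𝓞 L) L) • (1 : Matrix (Fin n) (Fin n) (AdeleRing (𝓞 L) L)) := by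
  have hT := isUnit_det_gramRA L e dV hdV dW hdW hdV0 hdW0
  rw [map_smul_eq, hz, Matrix.map_one _ (map_zero _) (map_one _), Matrix.transpose_smul, Matrix.transpose_one, Matrix.mul_smul, Matrix.mul_one,
    Matrix.smul_mul, Matrix.nonsing_inv_mul _ hT]

/-! ## §2 The module of conjugation by the scalar Levi element on ANY Haar measure of `N_Δ(𝔸)` -/

/-- **CENTRE SCALING ON `N_Δ(𝔸)`, EVERY HAAR MEASURE.**  Let `νN` be a Haar measure on `N_Δ(𝔸) = unipDelta` (any Borel structure) and `p ∈ H(𝔸)` the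
scalar Levi element of the positive real ray, `blk p = R (z·1, 0; 0, z⁻¹·1) R⁻¹`, `z = z(eˢ)` (★ `posRealIdele (expUnitNNReal s)`).  Then
`(u ↦ p⁻¹ u p)_* νN = e^{n²[L:ℚ]s} • νN`.  Proof: ★ `exists_haar_conjBy_scaling` gives the identity for ONE Haar measure on the chart's `N_Δ` and the
chart element `φ(z(eˢ))`, which IS `p` (★ `eq_of_blk_eq`); transport along the topological isomorphism `N_Δ(chart) ≅ unipDelta` and Haar uniqueness
(Mathlib `isMulLeftInvariant_eq_smul`; ★ `N_Δ(𝔸)` locally compact second countable).  [cite: Garrett2018, §3.10] [cite: MoeglinWaldspurger1995, II.1.6] -/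
theorem map_conj_centralRay_eq_smul (hdV0 : ∀ i, dV i ≠ 0) (hdW0 : ∀ i, dW i ≠ 0)
    [MeasurableSpace (unipDelta L e dV hdV dW hdW)] [BorelSpace (unipDelta L e dV hdV dW hdW)]
    (νN : Measure (unipDelta L e dV hdV dW hdW)) [νN.IsHaarMeasure] (s : ℝ) {p : HA L e dV hdV dW hdW}
    (hp : blk L e dV hdV dW hdW p =
      cayR (AdeleRing (𝓞 L) L) (Fin n) *
        Matrix.fromBlocks (((posRealIdele L (expUnitNNReal s) : (AdeleRing (𝓞 L) L)ˣ) : AdeleRing (𝓞 L) L) • (1 : Matrix (Fin n) (Fin n) (AdeleRing (𝓞 L) L))) 0 0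
          ((((posRealIdele L (expUnitNNReal s))⁻¹ : (AdeleRing (𝓞 L) L)ˣ) : AdeleRing (𝓞 L) L) • (1 : Matrix (Fin n) (Fin n) (AdeleRing (𝓞 L) L))) *
        cayRinv (AdeleRing (𝓞 L) L) (Fin n)) :
    Measure.map (fun u : unipDelta L e dV hdV dW hdW =>
        (⟨p⁻¹ * (u : HA L e dV hdV dW hdW) * p,
          conj_mem_unipDelta L e dV hdV dW hdW (isSiegelDelta_of_blk_eq_levi L e dV hdV dW hdW hp) u.2⟩ : unipDelta L e dV hdV dW hdW)) νN =
      ENNReal.ofReal (Real.exp (((n * n * Module.finrank ℚ L : ℕ) : ℝ) * s)) • νN := by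
  classical
  haveI : LocallyCompactSpace (unipDelta L e dV hdV dW hdW) := locallyCompactSpace_unipDelta L e dV hdV dW hdW
  haveI : SecondCountableTopology (unipDelta L e dV hdV dW hdW) := secondCountableTopology_unipDelta L e dV hdV dW hdW
  letI : MeasurableSpace (HA L e dV hdV dW hdW) := borel _
  haveI : BorelSpace (HA L e dV hdV dW hdW) := ⟨rfl⟩
  -- the chart and its centre scaling
  obtain ⟨Mg, Ng, eMN, φ, hS, hNg, hNgD, hφ⟩ := exists_siegelLeviChart L e dV hdV dW hdW hdV0 hdW0
  obtain ⟨μN, hμN, hscale⟩ := exists_haar_conjBy_scaling L e dV hdV dW hdW hdV0 hdW0 hS φ hNg hNgD hφ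
  -- the chart's centre element is `p`
  set a : ↥Mg := φ (scalarExp n L s) with ha
  have hpa : p = ((a : (siegelDelta L e dV hdV dW hdW : Subgroup (HA L e dV hdV dW hdW))) : HA L e dV hdV dW hdW) := by
    apply eq_of_blk_eq L e dV hdV dW hdW
    rw [hp, ha, hφ, coe_scalarExp, coe_scalarExp_inv,
      levi_D_block_scalar L e dV hdV dW hdW hdV0 hdW0 (conjAdele_posRealIdele_inv L (expUnitNNReal s))]
  -- `N_Δ(chart) ≅ unipDelta`
  have hmemN : ∀ x : ↥Ng, (((x : ↥Ng) : (siegelDelta L e dV hdV dW hdW : Subgroup (HA L e dV hdV dW hdW))) : HA L e dV hdV dW hdW) ∈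
      unipDelta L e dV hdV dW hdW := fun x =>
    mem_unipDelta_of_blk_eq_unip L e dV hdV dW hdW
      (blk_eq_unip L e dV hdV dW hdW ((x : (siegelDelta L e dV hdV dW hdW : Subgroup (HA L e dV hdV dW hdW))).2) ((hNg _).1 x.2) (hNgD _ x.2))
  have hmemNg : ∀ u : unipDelta L e dV hdV dW hdW,
      (⟨(u : HA L e dV hdV dW hdW), unipDelta_le_siegelDelta L e dV hdV dW hdW u.2⟩ :
        (siegelDelta L e dV hdV dW hdW : Subgroup (HA L e dV hdV dW hdW))) ∈ Ng := fun u => by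
    rw [hNg]
    obtain ⟨hP, hΔ, -⟩ := (mem_unipDelta_iff_blocks L e dV hdV dW hdW (u : HA L e dV hdV dW hdW)).1 u.2
    rw [blkA_eq_of_blkC_eq_zero ((blkC_eq_zero_iff _).2 hP)]
    exact hΔ
  let j : ↥Ng ≃* unipDelta L e dV hdV dW hdW :=
    { toFun := fun x => ⟨_, hmemN x⟩
      invFun := fun u => ⟨⟨(u : HA L e dV hdV dW hdW), unipDelta_le_siegelDelta L e dV hdV dW hdW u.2⟩, hmemNg u⟩
      left_inv := fun x => rfl
      right_inv := fun u => rfl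
      map_mul' := fun x y => rfl }
  have hjc : Continuous j := (continuous_subtype_val.comp continuous_subtype_val).subtype_mk _
  have hjsc : Continuous j.symm := (continuous_subtype_val.subtype_mk _).subtype_mk _
  have hjm : Measurable j := hjc.measurable
  haveI := hμN
  haveI : IsHaarMeasure (Measure.map j μN) := MulEquiv.isHaarMeasure_map (μ := μN) j hjc hjsc
  -- the conjugations
  have hconjc : Continuous (hS.conjBy a) :=
    Continuous.subtype_mk ((continuous_const.mul continuous_subtype_val).mul continuous_const) _
  have hcm : Measurable (fun u : unipDelta L e dV hdV dW hdW =>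
      (⟨p⁻¹ * (u : HA L e dV hdV dW hdW) * p,
        conj_mem_unipDelta L e dV hdV dW hdW (isSiegelDelta_of_blk_eq_levi L e dV hdV dW hdW hp) u.2⟩ : unipDelta L e dV hdV dW hdW)) :=
    (Continuous.subtype_mk ((continuous_const.mul continuous_subtype_val).mul continuous_const) _).measurable
  have hcomm : (fun u : unipDelta L e dV hdV dW hdW =>
      (⟨p⁻¹ * (u : HA L e dV hdV dW hdW) * p,
        conj_mem_unipDelta L e dV hdV dW hdW (isSiegelDelta_of_blk_eq_levi L e dV hdV dW hdW hp) u.2⟩ : unipDelta L e dV hdV dW hdW)) ∘ j =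
      j ∘ hS.conjBy a := by
    funext x
    apply Subtype.ext
    show p⁻¹ * _ * p = _
    rw [hpa]
    rfl
  -- the identity for the transported Haar measure `j_* μN`
  have h₀ : Measure.map (fun u : unipDelta L e dV hdV dW hdW =>
      (⟨p⁻¹ * (u : HA L e dV hdV dW hdW) * p,
        conj_mem_unipDelta L e dV hdV dW hdW (isSiegelDelta_of_blk_eq_levi L e dV hdV dW hdW hp) u.2⟩ : unipDelta L e dV hdV dW hdW))
        (Measure.map j μN) =
      ENNReal.ofReal (Real.exp (((n * n * Module.finrank ℚ L : ℕ) : ℝ) * s)) • Measure.map j μN := by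
    rw [Measure.map_map hcm hjm, hcomm, ← Measure.map_map hjm hconjc.measurable, hscale s, Measure.map_smul]
  -- Haar uniqueness: `νN = c • j_* μN`
  have hν : νN = haarScalarFactor νN (Measure.map j μN) • Measure.map j μN := isMulLeftInvariant_eq_smul νN (Measure.map j μN)
  rw [hν, Measure.map_smul, h₀, smul_comm]

/-! ## §3 The central-ray eigen-law of the intertwining integral -/

/-- **THE CENTRAL-RAY EIGEN-LAW.**  For a Siegel section `f ∈ I(s, χ)` (★ `IsSiegelDeltaSection`), ANY Haar measure `νN` on `N_Δ(𝔸)`, the scalar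
Levi element `p = m(z·1)` of the ray (`z = z(e^{s′})`) and every `h ∈ H(𝔸)`:
  `M f (p h) = e^{n²[L:ℚ]s′} · δ_{χ,s}(w_Δ p w_Δ) · M f (h)`,   `M f = intertwiningDelta νN f`, `w_Δ p w_Δ = m(z⁻¹·1)`.
(`u p = p (p⁻¹ u p)`, §2 for the substitution — a measurable equivalence, valid for the Bochner junk value too, so NO integrability hypothesis —,
`w_Δ p = (w_Δ p w_Δ) w_Δ` and the section law.)  [cite: MoeglinWaldspurger1995, II.1.6] [cite: HarrisKudlaSweet1996, §1 (1.15)] [cite: Garrett2018, §3.10] -/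
theorem intertwiningDelta_centralRay (hdV0 : ∀ i, dV i ≠ 0) (hdW0 : ∀ i, dW i ≠ 0)
    [MeasurableSpace (unipDelta L e dV hdV dW hdW)] [BorelSpace (unipDelta L e dV hdV dW hdW)]
    (νN : Measure (unipDelta L e dV hdV dW hdW)) [νN.IsHaarMeasure] (s' : ℝ) {p : HA L e dV hdV dW hdW}
    (hp : blk L e dV hdV dW hdW p =
      cayR (AdeleRing (𝓞 L) L) (Fin n) *
        Matrix.fromBlocks (((posRealIdele L (expUnitNNReal s') : (AdeleRing (𝓞 L) L)ˣ) : AdeleRing (𝓞 L) L) • (1 : Matrix (Fin n) (Fin n) (AdeleRing (𝓞 L) L))) 0 0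
          ((((posRealIdele L (expUnitNNReal s'))⁻¹ : (AdeleRing (𝓞 L) L)ˣ) : AdeleRing (𝓞 L) L) • (1 : Matrix (Fin n) (Fin n) (AdeleRing (𝓞 L) L))) *
        cayRinv (AdeleRing (𝓞 L) L) (Fin n))
    {χ : HeckeCharacter L} {s : ℂ} {f : HA L e dV hdV dW hdW → ℂ} (hf : IsSiegelDeltaSection L e dV hdV dW hdW χ s f) (h : HA L e dV hdV dW hdW) :
    intertwiningDelta L e dV hdV dW hdW νN f (p * h) =
      (Real.exp (((n * n * Module.finrank ℚ L : ℕ) : ℝ) * s') : ℂ) *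
        siegelDeltaCharacter L e dV hdV dW hdW χ s (weylDelta L e dV hdV dW hdW * p * weylDelta L e dV hdV dW hdW) *
        intertwiningDelta L e dV hdV dW hdW νN f h := by
  have hP : IsSiegelDelta L e dV hdV dW hdW p := isSiegelDelta_of_blk_eq_levi L e dV hdV dW hdW hp
  have hPw : IsSiegelDelta L e dV hdV dW hdW (weylDelta L e dV hdV dW hdW * p * weylDelta L e dV hdV dW hdW) :=
    isSiegelDelta_of_blk_eq_levi L e dV hdV dW hdW (blk_weylDelta_mul_mul_weylDelta_of_blk_eq_levi L e dV hdV dW hdW hp)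
  -- the conjugation `u ↦ p⁻¹ u p` as a homeomorphism of `N_Δ(𝔸)`
  have hmem' : ∀ u : unipDelta L e dV hdV dW hdW, p * (u : HA L e dV hdV dW hdW) * p⁻¹ ∈ unipDelta L e dV hdV dW hdW := fun u => by
    have hu := conj_mem_unipDelta L e dV hdV dW hdW (isSiegelDelta_inv L e dV hdV dW hdW hP) u.2
    rwa [inv_inv] at hu
  let ε : unipDelta L e dV hdV dW hdW ≃ₜ unipDelta L e dV hdV dW hdW :=
    { toFun := fun u => ⟨p⁻¹ * (u : HA L e dV hdV dW hdW) * p, conj_mem_unipDelta L e dV hdV dW hdW hP u.2⟩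
      invFun := fun u => ⟨p * (u : HA L e dV hdV dW hdW) * p⁻¹, hmem' u⟩
      left_inv := fun u => Subtype.ext (by
        show p * (p⁻¹ * (u : HA L e dV hdV dW hdW) * p) * p⁻¹ = u
        simp only [mul_assoc, mul_inv_cancel_left, mul_inv_cancel, mul_one])
      right_inv := fun u => Subtype.ext (by
        show p⁻¹ * (p * (u : HA L e dV hdV dW hdW) * p⁻¹) * p = u
        simp only [mul_assoc, inv_mul_cancel_left, inv_mul_cancel, mul_one])
      continuous_toFun := Continuous.subtype_mk ((continuous_const.mul continuous_subtype_val).mul continuous_const) _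
      continuous_invFun := Continuous.subtype_mk ((continuous_const.mul continuous_subtype_val).mul continuous_const) _ }
  have hε : Measure.map ε νN = ENNReal.ofReal (Real.exp (((n * n * Module.finrank ℚ L : ℕ) : ℝ) * s')) • νN :=
    map_conj_centralRay_eq_smul L e dV hdV dW hdW hdV0 hdW0 νN s' hp
  -- the integrand along the substitution
  have hint : ∀ u : unipDelta L e dV hdV dW hdW,
      f (weylDelta L e dV hdV dW hdW * (u : HA L e dV hdV dW hdW) * (p * h)) =
        f (weylDelta L e dV hdV dW hdW * p * ((ε u : unipDelta L e dV hdV dW hdW) : HA L e dV hdV dW hdW) * h) := fun u => by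
    show f _ = f (weylDelta L e dV hdV dW hdW * p * (p⁻¹ * (u : HA L e dV hdV dW hdW) * p) * h)
    congr 1
    simp only [mul_assoc, mul_inv_cancel_left]
  -- the section law at `w_Δ p w_Δ`
  have hsec : ∀ v : unipDelta L e dV hdV dW hdW,
      f (weylDelta L e dV hdV dW hdW * p * (v : HA L e dV hdV dW hdW) * h) =
        siegelDeltaCharacter L e dV hdV dW hdW χ s (weylDelta L e dV hdV dW hdW * p * weylDelta L e dV hdV dW hdW) *
          f (weylDelta L e dV hdV dW hdW * (v : HA L e dV hdV dW hdW) * h) := fun v => by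
    rw [← hf _ hPw]
    congr 1
    simp only [mul_assoc]
    rw [← mul_assoc (weylDelta L e dV hdV dW hdW) (weylDelta L e dV hdV dW hdW) ((v : HA L e dV hdV dW hdW) * h),
      weylDelta_mul_weylDelta, one_mul]
  unfold intertwiningDelta
  calc ∫ u, f (weylDelta L e dV hdV dW hdW * (u : HA L e dV hdV dW hdW) * (p * h)) ∂νN
      = ∫ u, (fun v : unipDelta L e dV hdV dW hdW => f (weylDelta L e dV hdV dW hdW * p * (v : HA L e dV hdV dW hdW) * h))
          (ε.toMeasurableEquiv u) ∂νN := integral_congr_ae (Filter.Eventually.of_forall fun u => hint u)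
    _ = ∫ v, f (weylDelta L e dV hdV dW hdW * p * (v : HA L e dV hdV dW hdW) * h) ∂(Measure.map ε.toMeasurableEquiv νN) :=
          (integral_map_equiv (μ := νN) ε.toMeasurableEquiv
            (fun v : unipDelta L e dV hdV dW hdW => f (weylDelta L e dV hdV dW hdW * p * (v : HA L e dV hdV dW hdW) * h))).symm
    _ = ∫ v, f (weylDelta L e dV hdV dW hdW * p * (v : HA L e dV hdV dW hdW) * h)
          ∂(ENNReal.ofReal (Real.exp (((n * n * Module.finrank ℚ L : ℕ) : ℝ) * s')) • νN) := by
          rw [Homeomorph.toMeasurableEquiv_coe, hε]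
    _ = Real.exp (((n * n * Module.finrank ℚ L : ℕ) : ℝ) * s') •
          ∫ v, f (weylDelta L e dV hdV dW hdW * p * (v : HA L e dV hdV dW hdW) * h) ∂νN := by
          rw [integral_smul_measure, ENNReal.toReal_ofReal (Real.exp_pos _).le]
    _ = _ := by
          simp_rw [hsec, integral_const_mul, Complex.real_smul, mul_assoc]

/-! ## §4 The eigenvalue: modulus of `w_Δ p w_Δ = m(z⁻¹·1)`, norm `exp([L:ℚ]·n·s′·(n∕2 − Re s))`, and `≠ 1` off `Re s = n∕2` -/

/-- `|det_Δ m(z⁻¹·1)|^{1∕2} = e^{−[L:ℚ] n s′∕2}` for `z = z(e^{s′})` (★ `modDelta_of_blk_eq_levi_scalar`, `|z(r)|_𝔸 = r^{[L:ℚ]}`).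
[cite: HarrisKudlaSweet1996, §1 (1.11)] [cite: Garrett2018, §3.10] -/
theorem modDelta_weylDelta_conj_centralRay (s' : ℝ) {p : HA L e dV hdV dW hdW}
    (hp : blk L e dV hdV dW hdW p =
      cayR (AdeleRing (𝓞 L) L) (Fin n) *
        Matrix.fromBlocks (((posRealIdele L (expUnitNNReal s') : (AdeleRing (𝓞 L) L)ˣ) : AdeleRing (𝓞 L) L) • (1 : Matrix (Fin n) (Fin n) (AdeleRing (𝓞 L) L))) 0 0
          ((((posRealIdele L (expUnitNNReal s'))⁻¹ : (AdeleRing (𝓞 L) L)ˣ) : AdeleRing (𝓞 L) L) • (1 : Matrix (Fin n) (Fin n) (AdeleRing (𝓞 L) L))) *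
        cayRinv (AdeleRing (𝓞 L) L) (Fin n)) :
    modDelta L e dV hdV dW hdW (weylDelta L e dV hdV dW hdW * p * weylDelta L e dV hdV dW hdW) =
      Real.exp (-(((Module.finrank ℚ L * n : ℕ) : ℝ) * s' / 2)) := by
  rw [modDelta_of_blk_eq_levi_scalar L e dV hdV dW hdW (blk_weylDelta_mul_mul_weylDelta_of_blk_eq_levi L e dV hdV dW hdW hp), ← coe_ideleNorm,
    map_pow, map_inv, ideleNorm_posRealIdele_holds L (expUnitNNReal s'), NNReal.coe_pow, NNReal.coe_inv, NNReal.coe_pow, coe_expUnitNNReal,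
    ← Real.exp_nat_mul, ← Real.exp_neg, ← Real.exp_nat_mul, Real.sqrt_eq_iff_eq_sq (Real.exp_pos _).le (Real.exp_pos _).le, sq, ← Real.exp_add]
  congr 1
  push_cast
  ring

/-- **THE NORM OF THE CENTRAL-RAY EIGENVALUE**: for a unitary `χ`,
`‖e^{n²[L:ℚ]s′} · δ_{χ,s}(m(z⁻¹·1))‖ = exp([L:ℚ]·n·s′·(n∕2 − Re s))` (★ `norm_siegelDeltaCharacter`).  At the rank-one centre (`n = 1`, `Re s = 0`) this is
`e^{[L:ℚ]s′∕2} ≠ 1`.  [cite: MoeglinWaldspurger1995, II.1.6] [cite: HarrisKudlaSweet1996, §1 (1.15)] -/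
theorem norm_centralRay_eigenvalue {χ : HeckeCharacter L} (hχ : χ.IsUnitary) (s : ℂ) (s' : ℝ) {p : HA L e dV hdV dW hdW}
    (hp : blk L e dV hdV dW hdW p =
      cayR (AdeleRing (𝓞 L) L) (Fin n) *
        Matrix.fromBlocks (((posRealIdele L (expUnitNNReal s') : (AdeleRing (𝓞 L) L)ˣ) : AdeleRing (𝓞 L) L) • (1 : Matrix (Fin n) (Fin n) (AdeleRing (𝓞 L) L))) 0 0
          ((((posRealIdele L (expUnitNNReal s'))⁻¹ : (AdeleRing (𝓞 L) L)ˣ) : AdeleRing (𝓞 L) L) • (1 : Matrix (Fin n) (Fin n) (AdeleRing (𝓞 L) L))) *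
        cayRinv (AdeleRing (𝓞 L) L) (Fin n)) :
    ‖(Real.exp (((n * n * Module.finrank ℚ L : ℕ) : ℝ) * s') : ℂ) *
        siegelDeltaCharacter L e dV hdV dW hdW χ s (weylDelta L e dV hdV dW hdW * p * weylDelta L e dV hdV dW hdW)‖ =
      Real.exp (((Module.finrank ℚ L * n : ℕ) : ℝ) * s' * ((n : ℝ) / 2 - s.re)) := by
  rw [norm_mul, Complex.norm_real, Real.norm_of_nonneg (Real.exp_pos _).le, norm_siegelDeltaCharacter L e dV hdV dW hdW hχ,
    modDelta_weylDelta_conj_centralRay L e dV hdV dW hdW s' hp, ← Real.exp_mul, ← Real.exp_add]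
  congr 1
  push_cast
  ring

/-- **… HENCE `≠ 1` OFF THE UNITARY AXIS**: for `s′ ≠ 0`, `0 < n` and `Re s ≠ n∕2` the central-ray eigenvalue is not `1` (its norm is not `1`).  This is the
hypothesis `hc₂` of ★ S5-W4 `K2LiuSingularSectionVanishesRay.eq_zero_of_isSiegelDeltaSection_add_centralRay_eigen` (at the centre `Re s = 0`).
[cite: JiangWu2016ChiB, Prop. 4.1] [cite: MoeglinWaldspurger1995, II.1.7] -/
theorem centralRay_eigenvalue_ne_one (hn : 0 < n) {χ : HeckeCharacter L} (hχ : χ.IsUnitary) {s : ℂ} (hs : s.re ≠ (n : ℝ) / 2)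
    {s' : ℝ} (hs' : s' ≠ 0) {p : HA L e dV hdV dW hdW}
    (hp : blk L e dV hdV dW hdW p =
      cayR (AdeleRing (𝓞 L) L) (Fin n) *
        Matrix.fromBlocks (((posRealIdele L (expUnitNNReal s') : (AdeleRing (𝓞 L) L)ˣ) : AdeleRing (𝓞 L) L) • (1 : Matrix (Fin n) (Fin n) (AdeleRing (𝓞 L) L))) 0 0
          ((((posRealIdele L (expUnitNNReal s'))⁻¹ : (AdeleRing (𝓞 L) L)ˣ) : AdeleRing (𝓞 L) L) • (1 : Matrix (Fin n) (Fin n) (AdeleRing (𝓞 L) L))) *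
        cayRinv (AdeleRing (𝓞 L) L) (Fin n)) :
    (Real.exp (((n * n * Module.finrank ℚ L : ℕ) : ℝ) * s') : ℂ) *
        siegelDeltaCharacter L e dV hdV dW hdW χ s (weylDelta L e dV hdV dW hdW * p * weylDelta L e dV hdV dW hdW) ≠ 1 := by
  intro h1
  have h := norm_centralRay_eigenvalue L e dV hdV dW hdW hχ s s' hp
  rw [h1, norm_one, eq_comm, Real.exp_eq_one_iff] at h
  refine (mul_ne_zero (mul_ne_zero ?_ hs') (sub_ne_zero.2 (Ne.symm hs))) h
  exact_mod_cast (Nat.mul_ne_zero (Module.finrank_pos (R := ℚ) (M := L)).ne' hn.ne')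

/-- **THE RAY EIGEN-LAW IN CONSUMER SHAPE** (the `heig` of ★ F1b-β `K2LiuRankOneCentreContinuation.apply_mul_eq_of_eqOn_halfPlane` ∕ the `h₂` of ★ S5-W4 ray
form): for every `p` of the scalar Levi shape of `z(e^{s′})`, `M f (p h) = κ · M f (h)` for all `h`, with ONE scalar
`κ = e^{n²[L:ℚ]s′}·δ_{χ,s}(w_Δ p w_Δ)` independent of `h` and of the Haar measure, and `κ ≠ 1` when `s′ ≠ 0`, `Re s ≠ n∕2`.
[cite: MoeglinWaldspurger1995, II.1.6] [cite: JiangWu2016ChiB, Prop. 4.1] -/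
theorem exists_centralRay_eigenvalue (hdV0 : ∀ i, dV i ≠ 0) (hdW0 : ∀ i, dW i ≠ 0) (hn : 0 < n)
    [MeasurableSpace (unipDelta L e dV hdV dW hdW)] [BorelSpace (unipDelta L e dV hdV dW hdW)]
    (νN : Measure (unipDelta L e dV hdV dW hdW)) [νN.IsHaarMeasure] {χ : HeckeCharacter L} (hχ : χ.IsUnitary) {s : ℂ} (hs : s.re ≠ (n : ℝ) / 2)
    {s' : ℝ} (hs' : s' ≠ 0) {p : HA L e dV hdV dW hdW}
    (hp : blk L e dV hdV dW hdW p =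
      cayR (AdeleRing (𝓞 L) L) (Fin n) *
        Matrix.fromBlocks (((posRealIdele L (expUnitNNReal s') : (AdeleRing (𝓞 L) L)ˣ) : AdeleRing (𝓞 L) L) • (1 : Matrix (Fin n) (Fin n) (AdeleRing (𝓞 L) L))) 0 0
          ((((posRealIdele L (expUnitNNReal s'))⁻¹ : (AdeleRing (𝓞 L) L)ˣ) : AdeleRing (𝓞 L) L) • (1 : Matrix (Fin n) (Fin n) (AdeleRing (𝓞 L) L))) *
        cayRinv (AdeleRing (𝓞 L) L) (Fin n)) :
    ∃ κ : ℂ, κ ≠ 1 ∧ ∀ {f : HA L e dV hdV dW hdW → ℂ}, IsSiegelDeltaSection L e dV hdV dW hdW χ s f →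
      ∀ h, intertwiningDelta L e dV hdV dW hdW νN f (p * h) = κ * intertwiningDelta L e dV hdV dW hdW νN f h :=
  ⟨_, centralRay_eigenvalue_ne_one L e dV hdV dW hdW hn hχ hs hs' hp, fun hf h =>
    intertwiningDelta_centralRay L e dV hdV dW hdW hdV0 hdW0 νN s' hp hf h⟩

end Summit.HodgeConjecture.HodgeConjecture.Cruxes.HLiu418.K2LiuIntertwiningCentralRayEigen

end
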